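import Literature.NumberTheory.Transcendental.SlabCharts
import Literature.Analysis.Calculus.MonomialUnits
import Literature.ModelTheory.ExponentialFields.CylindricalDecompositionProofs
import Literature.ModelTheory.ExponentialFields.SignInvariantCells
import HarnessLib

/-!
# Jung's projection method: the band regions over a base chart are adapted to `B`

Let `B ⊆ ℝᵈ⁺¹` be presented by sign conditions on a finite family `Ps` of polynomials over `ℚ`,
`Sh` a rational shear, `χ` a base map continuous on the open cube `Ω` and `W_0 < ⋯ < W_{p-1}`
continuous walls over `Ω` such that, along `Sh ∘ (χ × id)`, every non-zero member of `Ps` vanishes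
only on the walls. For `j = 0, …, p` let `Band_j` be the region over `χ(Ω)` between the walls
`W_{j-1} < W_j` (`W_{-1} = −∞`, `W_p = +∞`, the conventions `bandLower` / `bandUpper` of the tree's
cylindrical decomposition file). Then:

* `isPreconnected_bandRegion` — every `Band_j` is preconnected;
* `image_bandRegion_subset_or_disjoint` — `Sh(Band_j) ⊆ B` or `Sh(Band_j) ∩ B = ∅`
  (sign invariance, `subset_or_disjoint_of_forall_ne_zero_or_eq_zero`);
* `ne_extreme_of_image_bandRegion_subset` — if `Sh⁻¹(B)` is bounded, only the bands strictly
  between two walls can lie in `B`;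
* `exists_wall_or_band_of_mem` — every point of `Sh⁻¹(B)` over `χ(Ω)` lies on a wall graph or in a
  band `Band_j ⊆ Sh⁻¹(B)` strictly between two walls.

Namespace `Literature.NumberTheory.Transcendental.JungPreparation`.

## References

* S. Basu, R. Pollack, M.-F. Roy, *Algorithms in Real Algebraic Geometry* (2006), §5.1
  (Def. 5.1, Prop. 5.3, Cor. 5.7); J. Kollár, *Lectures on Resolution of Singularities* (2007), §2.3.
-/

noncomputable section

open Set
open Literature.ModelTheory.ExponentialFields
open Literature.ModelTheory.ExponentialFields.CylindricalDecomposition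

namespace Literature.NumberTheory.Transcendental.JungPreparation

variable {d p : ℕ}

/-- Continuity of `z ↦ (χ(z'), g(z))` on a set whose points have `z' ∈ Ω`. [folklore] -/
theorem continuousOn_snoc_comp {χ : (Fin d → ℝ) → (Fin d → ℝ)} {Ω : Set (Fin d → ℝ)}
    (hχ : ContinuousOn χ Ω) {D : Set (Fin (d + 1) → ℝ)} (hD : ∀ z ∈ D, Fin.init z ∈ Ω)
    {g : (Fin (d + 1) → ℝ) → ℝ} (hg : ContinuousOn g D) :
    ContinuousOn (fun z => (Fin.snoc (χ (Fin.init z)) (g z) : Fin (d + 1) → ℝ)) D := by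
  have hinit : Continuous fun z : Fin (d + 1) → ℝ => Fin.init z :=
    continuous_pi fun j => continuous_apply (Fin.castSucc j)
  refine continuousOn_pi.2 fun i => ?_
  refine Fin.lastCases ?_ (fun j => ?_) i
  · simpa only [Fin.snoc_last] using hg
  · simp only [Fin.snoc_castSucc]
    exact ((continuous_apply j).comp_continuousOn hχ).comp hinit.continuousOn hD

/-- A product set `Ω × J ⊆ ℝᵈ⁺¹` (last coordinate in `J`) with `Ω` the open cube and `J` convex is
convex, and its points have first coordinates in `Ω`. [folklore] -/
theorem convex_pi_snoc {J : Set ℝ} (hJ : Convex ℝ J) :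
    Convex ℝ {z : Fin (d + 1) → ℝ | Fin.init z ∈ Set.pi Set.univ (fun _ : Fin d => Ioo (0 : ℝ) 1) ∧
      z (Fin.last d) ∈ J} := by
  have h : {z : Fin (d + 1) → ℝ | Fin.init z ∈ Set.pi Set.univ (fun _ : Fin d => Ioo (0 : ℝ) 1) ∧
      z (Fin.last d) ∈ J} = Set.pi Set.univ (Fin.lastCases J (fun _ => Ioo (0 : ℝ) 1)) := by
    ext z
    simp only [mem_setOf_eq, mem_pi, mem_univ, true_imp_iff]
    constructor
    · rintro ⟨h1, h2⟩ i
      refine Fin.lastCases ?_ (fun j => ?_) i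
      · simpa using h2
      · simpa [Fin.init] using h1 j
    · intro h
      exact ⟨fun j => by simpa [Fin.init] using h (Fin.castSucc j), by simpa using h (Fin.last d)⟩
  rw [h]
  exact convex_pi fun i _ => Fin.lastCases (motive := fun i => Convex ℝ (Fin.lastCases J
    (fun _ => Ioo (0 : ℝ) 1) i : Set ℝ)) (by simpa using hJ) (fun j => by simpa using convex_Ioo _ _) i

/-- **Band regions are preconnected.** [folklore] -/
theorem isPreconnected_bandRegion {χ : (Fin d → ℝ) → (Fin d → ℝ)}
    (hχ : ContinuousOn χ (Set.pi Set.univ (fun _ : Fin d => Ioo (0 : ℝ) 1)))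
    {W : Fin p → (Fin d → ℝ) → ℝ}
    (hW : ∀ m, ContinuousOn (W m) (Set.pi Set.univ (fun _ : Fin d => Ioo (0 : ℝ) 1)))
    (hmono : ∀ σ ∈ Set.pi Set.univ (fun _ : Fin d => Ioo (0 : ℝ) 1), StrictMono fun m => W m σ)
    (j : Fin (p + 1)) :
    IsPreconnected {u : Fin (d + 1) → ℝ | ∃ σ ∈ Set.pi Set.univ (fun _ : Fin d => Ioo (0 : ℝ) 1),
      Fin.init u = χ σ ∧ bandLower W j σ < (u (Fin.last d) : EReal) ∧
        (u (Fin.last d) : EReal) < bandUpper W j σ} := by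
  set Ω := Set.pi Set.univ (fun _ : Fin d => Ioo (0 : ℝ) 1) with hΩ
  -- a uniform parametrisation: `(σ, s) ↦ (χ σ, base σ + s)` on a convex product set
  -- base and parameter interval depend on the kind of band
  by_cases hj0 : j = 0
  · by_cases hp : p = 0
    · -- no walls: the whole cylinder
      subst hp
      have hjl : j = Fin.last 0 := Fin.ext (by have := j.2; simp only [Fin.val_last]; omega)
      set D := {z : Fin (d + 1) → ℝ | Fin.init z ∈ Ω ∧ z (Fin.last d) ∈ (Set.univ : Set ℝ)} with hD
      have himage : {u : Fin (d + 1) → ℝ | ∃ σ ∈ Ω, Fin.init u = χ σ ∧ bandLower W j σ < (u (Fin.last d) : EReal) ∧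
          (u (Fin.last d) : EReal) < bandUpper W j σ} =
          (fun z => (Fin.snoc (χ (Fin.init z)) (z (Fin.last d)) : Fin (d + 1) → ℝ)) '' D := by
        ext u
        simp only [mem_setOf_eq, mem_image, hD, mem_univ, and_true]
        constructor
        · rintro ⟨σ, hσ, hinit, -, -⟩
          exact ⟨Fin.snoc σ (u (Fin.last d)), by simpa using hσ, by simp [← hinit, Fin.snoc_init_self]⟩
        · rintro ⟨z, hz, rfl⟩
          refine ⟨Fin.init z, hz, by simp, ?_, ?_⟩
          · rw [hj0, bandLower_zero]; exact EReal.bot_lt_coe _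
          · rw [hjl, bandUpper_last]; exact EReal.coe_lt_top _
      rw [himage]
      exact ((convex_pi_snoc convex_univ).isPreconnected).image _
        (continuousOn_snoc_comp hχ (fun z hz => hz.1) (continuous_apply _).continuousOn)
    · -- the lowest band `t < W_0`
      obtain ⟨p', rfl⟩ : ∃ p', p = p' + 1 := Nat.exists_eq_succ_of_ne_zero hp
      set D := {z : Fin (d + 1) → ℝ | Fin.init z ∈ Ω ∧ z (Fin.last d) ∈ Iio (0 : ℝ)} with hD
      have himage : {u : Fin (d + 1) → ℝ | ∃ σ ∈ Ω, Fin.init u = χ σ ∧ bandLower W j σ < (u (Fin.last d) : EReal) ∧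
          (u (Fin.last d) : EReal) < bandUpper W j σ} =
          (fun z => (Fin.snoc (χ (Fin.init z)) (W 0 (Fin.init z) + z (Fin.last d)) : Fin (d + 1) → ℝ)) '' D := by
        ext u
        simp only [mem_setOf_eq, mem_image, hD, mem_Iio]
        constructor
        · rintro ⟨σ, hσ, hinit, -, hup⟩
          rw [hj0, bandUpper_zero, EReal.coe_lt_coe_iff] at hup
          refine ⟨Fin.snoc σ (u (Fin.last d) - W 0 σ), ⟨by simpa using hσ, by simp; linarith⟩, ?_⟩
          simp [← hinit, Fin.snoc_init_self]
        · rintro ⟨z, ⟨hz, hneg⟩, rfl⟩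
          refine ⟨Fin.init z, hz, by simp, ?_, ?_⟩
          · rw [hj0, bandLower_zero]; exact EReal.bot_lt_coe _
          · rw [hj0, bandUpper_zero, Fin.snoc_last, EReal.coe_lt_coe_iff]; linarith
      rw [himage]
      exact ((convex_pi_snoc (convex_Iio 0)).isPreconnected).image _
        (continuousOn_snoc_comp hχ (fun z hz => hz.1)
          (((hW 0).comp (continuous_pi fun j => continuous_apply (Fin.castSucc j)).continuousOn
            (fun z hz => hz.1)).add (continuous_apply _).continuousOn))
  · by_cases hjl : j = Fin.last p
    · -- the highest band `W_{p-1} < t`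
      have hp : p ≠ 0 := by rintro rfl; exact hj0 (hjl.trans rfl)
      obtain ⟨p', rfl⟩ : ∃ p', p = p' + 1 := Nat.exists_eq_succ_of_ne_zero hp
      set D := {z : Fin (d + 1) → ℝ | Fin.init z ∈ Ω ∧ z (Fin.last d) ∈ Ioi (0 : ℝ)} with hD
      have himage : {u : Fin (d + 1) → ℝ | ∃ σ ∈ Ω, Fin.init u = χ σ ∧ bandLower W j σ < (u (Fin.last d) : EReal) ∧
          (u (Fin.last d) : EReal) < bandUpper W j σ} =
          (fun z => (Fin.snoc (χ (Fin.init z)) (W (Fin.last p') (Fin.init z) + z (Fin.last d)) :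
            Fin (d + 1) → ℝ)) '' D := by
        ext u
        simp only [mem_setOf_eq, mem_image, hD, mem_Ioi]
        constructor
        · rintro ⟨σ, hσ, hinit, hlo, -⟩
          rw [hjl, bandLower_last, EReal.coe_lt_coe_iff] at hlo
          refine ⟨Fin.snoc σ (u (Fin.last d) - W (Fin.last p') σ), ⟨by simpa using hσ, by simp; linarith⟩, ?_⟩
          simp [← hinit, Fin.snoc_init_self]
        · rintro ⟨z, ⟨hz, hpos⟩, rfl⟩
          refine ⟨Fin.init z, hz, by simp, ?_, ?_⟩
          · rw [hjl, bandLower_last, Fin.snoc_last, EReal.coe_lt_coe_iff]; linarith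
          · rw [hjl, bandUpper_last]; exact EReal.coe_lt_top _
      rw [himage]
      exact ((convex_pi_snoc (convex_Ioi 0)).isPreconnected).image _
        (continuousOn_snoc_comp hχ (fun z hz => hz.1)
          (((hW _).comp (continuous_pi fun j => continuous_apply (Fin.castSucc j)).continuousOn
            (fun z hz => hz.1)).add (continuous_apply _).continuousOn))
    · -- a band strictly between two walls: the slab chart image
      set lo := W (j.pred hj0) with hlo
      set hi := W (j.castPred hjl) with hhi
      have hlt : ∀ σ ∈ Ω, lo σ < hi σ := fun σ hσ => hmono σ hσ (by
        rw [Fin.lt_def, Fin.val_pred, Fin.coe_castPred]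
        exact Nat.pred_lt (fun h => hj0 (Fin.ext h)))
      set Ψ₀ : (Fin (d + 1) → ℝ) → (Fin (d + 1) → ℝ) := fun z =>
        Fin.snoc (χ (Fin.init z)) (lo (Fin.init z) + z (Fin.last d) * (hi (Fin.init z) - lo (Fin.init z)))
        with hΨ₀
      have himage : {u : Fin (d + 1) → ℝ | ∃ σ ∈ Ω, Fin.init u = χ σ ∧ bandLower W j σ < (u (Fin.last d) : EReal) ∧
          (u (Fin.last d) : EReal) < bandUpper W j σ} =
          Ψ₀ '' Set.pi Set.univ (fun _ : Fin (d + 1) => Ioo (0 : ℝ) 1) := by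
        rw [image_slabChart χ lo hi Ψ₀ (fun z => rfl) hlt]
        ext u
        simp only [mem_setOf_eq, bandLower_of_ne_zero W j hj0, bandUpper_of_ne_last W j hjl,
          EReal.coe_lt_coe_iff, mem_Ioo, hlo, hhi, hΩ]
      rw [himage]
      refine ((convex_pi fun _ _ => convex_Ioo (0 : ℝ) 1).isPreconnected).image _
        (continuousOn_snoc_comp hχ (fun z hz => init_mem_pi_Ioo hz) ?_)
      have hinit : Continuous fun z : Fin (d + 1) → ℝ => Fin.init z :=
        continuous_pi fun j => continuous_apply (Fin.castSucc j)
      have hl : ContinuousOn (fun z : Fin (d + 1) → ℝ => lo (Fin.init z))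
          (Set.pi Set.univ (fun _ : Fin (d + 1) => Ioo (0 : ℝ) 1)) :=
        (hW _).comp hinit.continuousOn fun z hz => init_mem_pi_Ioo hz
      have hh : ContinuousOn (fun z : Fin (d + 1) → ℝ => hi (Fin.init z))
          (Set.pi Set.univ (fun _ : Fin (d + 1) => Ioo (0 : ℝ) 1)) :=
        (hW _).comp hinit.continuousOn fun z hz => init_mem_pi_Ioo hz
      exact hl.add ((continuous_apply _).continuousOn.mul (hh.sub hl))

/-- **Band regions are adapted to `B`.** If every non-zero polynomial of the sign presentation of
`B` vanishes along `Sh ∘ (χ × id)` only on the walls, then the sheared band region `Sh(Band_j)`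
lies inside `B` or is disjoint from it (Basu–Pollack–Roy 2006, proof of Cor. 5.7). [folklore] -/
theorem image_bandRegion_subset_or_disjoint {Ps : Finset (MvPolynomial (Fin (d + 1)) ℚ)}
    {T : Set (Ps → SignType)} {B : Set (Fin (d + 1) → ℝ)}
    (hB : B = {x | (fun q : Ps => SignType.sign (MvPolynomial.aeval x (q : MvPolynomial (Fin (d + 1)) ℚ))) ∈ T})
    (Sh : (Fin (d + 1) → ℝ) → (Fin (d + 1) → ℝ)) (hSh : Continuous Sh)
    {χ : (Fin d → ℝ) → (Fin d → ℝ)} (hχ : ContinuousOn χ (Set.pi Set.univ (fun _ : Fin d => Ioo (0 : ℝ) 1)))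
    {W : Fin p → (Fin d → ℝ) → ℝ}
    (hW : ∀ m, ContinuousOn (W m) (Set.pi Set.univ (fun _ : Fin d => Ioo (0 : ℝ) 1)))
    (hmono : ∀ σ ∈ Set.pi Set.univ (fun _ : Fin d => Ioo (0 : ℝ) 1), StrictMono fun m => W m σ)
    (hroots : ∀ q : Ps, (q : MvPolynomial (Fin (d + 1)) ℚ) ≠ 0 →
      ∀ σ ∈ Set.pi Set.univ (fun _ : Fin d => Ioo (0 : ℝ) 1), ∀ t : ℝ,
        MvPolynomial.aeval (Sh (Fin.snoc (χ σ) t)) (q : MvPolynomial (Fin (d + 1)) ℚ) = 0 → ∃ m, t = W m σ)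
    (j : Fin (p + 1)) :
    Sh '' {u : Fin (d + 1) → ℝ | ∃ σ ∈ Set.pi Set.univ (fun _ : Fin d => Ioo (0 : ℝ) 1),
        Fin.init u = χ σ ∧ bandLower W j σ < (u (Fin.last d) : EReal) ∧
          (u (Fin.last d) : EReal) < bandUpper W j σ} ⊆ B ∨
      Disjoint (Sh '' {u : Fin (d + 1) → ℝ | ∃ σ ∈ Set.pi Set.univ (fun _ : Fin d => Ioo (0 : ℝ) 1),
        Fin.init u = χ σ ∧ bandLower W j σ < (u (Fin.last d) : EReal) ∧
          (u (Fin.last d) : EReal) < bandUpper W j σ}) B := by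
  refine subset_or_disjoint_of_forall_ne_zero_or_eq_zero hB
    ((isPreconnected_bandRegion hχ hW hmono j).image Sh hSh.continuousOn) fun q => ?_
  by_cases hq : (q : MvPolynomial (Fin (d + 1)) ℚ) = 0
  · exact Or.inr fun x _ => by rw [hq, map_zero]
  · refine Or.inl ?_
    rintro _ ⟨u, ⟨σ, hσ, hinit, hband⟩, rfl⟩ h0
    have hu : u = Fin.snoc (χ σ) (u (Fin.last d)) := by rw [← hinit, Fin.snoc_init_self]
    rw [hu] at h0
    obtain ⟨m, hm⟩ := hroots q hq σ hσ _ h0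
    exact ((mem_band_iff W σ (hmono σ hσ) j (u (Fin.last d))).1 hband).1 m hm.symm

/-- **Only bands strictly between two walls can lie in a bounded set**: if `Sh⁻¹(B)` is bounded and
`Sh(Band_j) ⊆ B` then `0 < j < p`. [folklore] -/
theorem ne_extreme_of_image_bandRegion_subset {B : Set (Fin (d + 1) → ℝ)}
    (Sh : (Fin (d + 1) → ℝ) → (Fin (d + 1) → ℝ)) (hbdd : Bornology.IsBounded {z | Sh z ∈ B})
    (χ : (Fin d → ℝ) → (Fin d → ℝ)) (W : Fin p → (Fin d → ℝ) → ℝ) (j : Fin (p + 1))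
    (hsub : Sh '' {u : Fin (d + 1) → ℝ | ∃ σ ∈ Set.pi Set.univ (fun _ : Fin d => Ioo (0 : ℝ) 1),
        Fin.init u = χ σ ∧ bandLower W j σ < (u (Fin.last d) : EReal) ∧
          (u (Fin.last d) : EReal) < bandUpper W j σ} ⊆ B) :
    j ≠ 0 ∧ j ≠ Fin.last p := by
  obtain ⟨C, hC⟩ := hbdd.exists_norm_le
  set σ₀ : Fin d → ℝ := fun _ => 2⁻¹ with hσ₀
  have hσ₀ : σ₀ ∈ Set.pi Set.univ (fun _ : Fin d => Ioo (0 : ℝ) 1) := fun _ _ => ⟨by norm_num, by norm_num⟩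
  -- a point of the band region over `σ₀` with last coordinate `t` has norm `≥ |t|`
  have key : ∀ t : ℝ, bandLower W j σ₀ < (t : EReal) → (t : EReal) < bandUpper W j σ₀ → |t| ≤ C := by
    intro t hlo hup
    have hmem : (Fin.snoc (χ σ₀) t : Fin (d + 1) → ℝ) ∈ {z | Sh z ∈ B} :=
      hsub ⟨Fin.snoc (χ σ₀) t, ⟨σ₀, hσ₀, by simp, by simpa using hlo, by simpa using hup⟩, rfl⟩
    have h := hC _ hmem
    have h2 := norm_le_pi_norm (Fin.snoc (χ σ₀) t : Fin (d + 1) → ℝ) (Fin.last d)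
    rw [Fin.snoc_last, Real.norm_eq_abs] at h2
    linarith
  constructor
  · rintro rfl
    rcases Nat.eq_zero_or_pos p with hp | hp
    · subst hp
      have h := key (-(|C| + 1)) (by rw [bandLower_zero]; exact EReal.bot_lt_coe _)
        (by rw [show (0 : Fin 1) = Fin.last 0 from rfl, bandUpper_last]; exact EReal.coe_lt_top _)
      have h2 : (0 : ℝ) < |C| + 1 := by positivity
      have : |(-(|C| + 1) : ℝ)| = |C| + 1 := by rw [abs_neg, abs_of_pos h2]
      linarith [le_abs_self C]
    · obtain ⟨p', rfl⟩ : ∃ p', p = p' + 1 := ⟨p - 1, by omega⟩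
      set t : ℝ := -(|C| + 1) - |W 0 σ₀| with ht
      have h := key t (by rw [bandLower_zero]; exact EReal.bot_lt_coe _)
        (by rw [bandUpper_zero, EReal.coe_lt_coe_iff, ht]; linarith [neg_abs_le (W 0 σ₀), abs_nonneg C])
      have : |C| + 1 ≤ |t| := by
        have h1 : t = -((|C| + 1) + |W 0 σ₀|) := by rw [ht]; ring
        have h2 : (0 : ℝ) ≤ (|C| + 1) + |W 0 σ₀| := by positivity
        rw [h1, abs_neg, abs_of_nonneg h2]
        linarith [abs_nonneg (W 0 σ₀)]
      linarith [le_abs_self C]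
  · rintro rfl
    rcases Nat.eq_zero_or_pos p with hp | hp
    · subst hp
      have h := key (|C| + 1) (by rw [show Fin.last 0 = (0 : Fin 1) from rfl, bandLower_zero]; exact EReal.bot_lt_coe _)
        (by rw [bandUpper_last]; exact EReal.coe_lt_top _)
      have h2 : (0 : ℝ) < |C| + 1 := by positivity
      rw [abs_of_pos h2] at h
      linarith [le_abs_self C]
    · obtain ⟨p', rfl⟩ : ∃ p', p = p' + 1 := ⟨p - 1, by omega⟩
      set t : ℝ := (|C| + 1) + |W (Fin.last p') σ₀| with ht
      have h := key t (by
          rw [bandLower_last, EReal.coe_lt_coe_iff, ht]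
          linarith [le_abs_self (W (Fin.last p') σ₀), abs_nonneg C])
        (by rw [bandUpper_last]; exact EReal.coe_lt_top _)
      have h2 : (0 : ℝ) < |C| + 1 + |W (Fin.last p') σ₀| := by positivity
      rw [abs_of_pos h2] at h
      linarith [le_abs_self C, abs_nonneg (W (Fin.last p') σ₀)]

/-- **Cover of `Sh⁻¹(B)` over `χ(Ω)`**: a point `z` with `z' = χ(σ)`, `σ ∈ Ω`, and `Sh z ∈ B` lies
on a wall graph (`z_d = W_m(σ)`) or strictly between two consecutive walls `W_{j-1}(σ) < z_d <
W_j(σ)` whose whole sheared band lies in `B`. [folklore] -/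
theorem exists_wall_or_band_of_mem {Ps : Finset (MvPolynomial (Fin (d + 1)) ℚ)}
    {T : Set (Ps → SignType)} {B : Set (Fin (d + 1) → ℝ)}
    (hB : B = {x | (fun q : Ps => SignType.sign (MvPolynomial.aeval x (q : MvPolynomial (Fin (d + 1)) ℚ))) ∈ T})
    (Sh : (Fin (d + 1) → ℝ) → (Fin (d + 1) → ℝ)) (hSh : Continuous Sh)
    (hbdd : Bornology.IsBounded {z | Sh z ∈ B})
    {χ : (Fin d → ℝ) → (Fin d → ℝ)} (hχ : ContinuousOn χ (Set.pi Set.univ (fun _ : Fin d => Ioo (0 : ℝ) 1)))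
    {W : Fin p → (Fin d → ℝ) → ℝ}
    (hW : ∀ m, ContinuousOn (W m) (Set.pi Set.univ (fun _ : Fin d => Ioo (0 : ℝ) 1)))
    (hmono : ∀ σ ∈ Set.pi Set.univ (fun _ : Fin d => Ioo (0 : ℝ) 1), StrictMono fun m => W m σ)
    (hroots : ∀ q : Ps, (q : MvPolynomial (Fin (d + 1)) ℚ) ≠ 0 →
      ∀ σ ∈ Set.pi Set.univ (fun _ : Fin d => Ioo (0 : ℝ) 1), ∀ t : ℝ,
        MvPolynomial.aeval (Sh (Fin.snoc (χ σ) t)) (q : MvPolynomial (Fin (d + 1)) ℚ) = 0 → ∃ m, t = W m σ)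
    {z : Fin (d + 1) → ℝ} (hzB : Sh z ∈ B) {σ : Fin d → ℝ}
    (hσ : σ ∈ Set.pi Set.univ (fun _ : Fin d => Ioo (0 : ℝ) 1)) (hinit : Fin.init z = χ σ) :
    (∃ m, z (Fin.last d) = W m σ) ∨
      ∃ (j : Fin (p + 1)) (hj0 : j ≠ 0) (hjl : j ≠ Fin.last p),
        W (j.pred hj0) σ < z (Fin.last d) ∧ z (Fin.last d) < W (j.castPred hjl) σ ∧
        Sh '' {u : Fin (d + 1) → ℝ | ∃ σ ∈ Set.pi Set.univ (fun _ : Fin d => Ioo (0 : ℝ) 1),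
          Fin.init u = χ σ ∧ bandLower W j σ < (u (Fin.last d) : EReal) ∧
            (u (Fin.last d) : EReal) < bandUpper W j σ} ⊆ B := by
  rcases exists_eq_or_exists_mem_band W σ (hmono σ hσ) (z (Fin.last d)) with h | ⟨j, hband⟩
  · exact Or.inl h
  · right
    have hzmem : Sh z ∈ Sh '' {u : Fin (d + 1) → ℝ | ∃ σ ∈ Set.pi Set.univ (fun _ : Fin d => Ioo (0 : ℝ) 1),
        Fin.init u = χ σ ∧ bandLower W j σ < (u (Fin.last d) : EReal) ∧
          (u (Fin.last d) : EReal) < bandUpper W j σ} := ⟨z, ⟨σ, hσ, hinit, hband⟩, rfl⟩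
    have hsub : Sh '' {u : Fin (d + 1) → ℝ | ∃ σ ∈ Set.pi Set.univ (fun _ : Fin d => Ioo (0 : ℝ) 1),
        Fin.init u = χ σ ∧ bandLower W j σ < (u (Fin.last d) : EReal) ∧
          (u (Fin.last d) : EReal) < bandUpper W j σ} ⊆ B := by
      rcases image_bandRegion_subset_or_disjoint hB Sh hSh hχ hW hmono hroots j with h | h
      · exact h
      · exact absurd (Set.disjoint_left.1 h hzmem) (not_not.2 hzB)
    obtain ⟨hj0, hjl⟩ := ne_extreme_of_image_bandRegion_subset Sh hbdd χ W j hsub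
    refine ⟨j, hj0, hjl, ?_, ?_, hsub⟩
    · have h := hband.1
      rwa [bandLower_of_ne_zero W j hj0, EReal.coe_lt_coe_iff] at h
    · have h := hband.2
      rwa [bandUpper_of_ne_last W j hjl, EReal.coe_lt_coe_iff] at h

/-- Band regions lie in the cylinder over `χ(Ω)`. [folklore] -/
theorem bandRegion_subset_cylinder {χ : (Fin d → ℝ) → (Fin d → ℝ)} {W : Fin p → (Fin d → ℝ) → ℝ}
    (j : Fin (p + 1)) :
    {u : Fin (d + 1) → ℝ | ∃ σ ∈ Set.pi Set.univ (fun _ : Fin d => Ioo (0 : ℝ) 1),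
      Fin.init u = χ σ ∧ bandLower W j σ < (u (Fin.last d) : EReal) ∧
        (u (Fin.last d) : EReal) < bandUpper W j σ} ⊆
      {u | Fin.init u ∈ χ '' Set.pi Set.univ (fun _ : Fin d => Ioo (0 : ℝ) 1)} := by
  rintro u ⟨σ, hσ, hinit, -⟩
  exact ⟨σ, hσ, hinit.symm⟩

end Literature.NumberTheory.Transcendental.JungPreparation
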